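import Summits.Ventures.YMGap.Thresholds.HaarFourthMomentSUNCross
import Summits.Ventures.YMGap.Thresholds.HaarThirdMomentSU3
import HarnessLib

/-!
# `∫_{SU(N)} |tr U|⁴ dU = 2` for EVERY `N ≥ 3` — the fourth moment of the character is that of a complex Gaussian
# (row type C-PRESS, `β = 0` inputs, part 19c)

Cell `pub-ymgap`, seat ds-1 (gen 11). HONEST FRAMING: pure compact-group integration for a compact group `G ≅ SU(N)`, `N = 2 + n ≥ 3`;
nothing lattice-specific, nothing about the continuum or the Clay problem. Kernel theorems only, 0 compute, no definitions.

`|tr U|⁴ = Σ_{i,k,j,l} U_ii U_kk Ū_jj Ū_ll`. The left phase twists `diag(i at a, −i at b)` (`diagonal_phase_mem`) multiply such a monomial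
by a fourth root of unity which is `≠ 1` unless the multisets `{i,k}` and `{j,l}` agree (`integral_diag4_eq_zero`; for the pattern
`U_ii² Ū_jj²` the spare third index is needed, whence `N ≥ 3`); the survivors are `N` terms `∫|U_ii|⁴ = 2/(N(N+1))` (part 19a) and
`2N(N−1)` terms `∫|U_ii|²|U_jj|² = 1/(N²−1)` (part 19b), so ★★ `∫ |tr ρ(g)|⁴ dg = 2/(N+1) + 2N/(N+1) = 2` (`integral_normSq_trace_sq`):
the number of invariants in `V ⊗ V ⊗ V̄ ⊗ V̄`, obtained without characters or Weingarten calculus. With `∫|tr|² = 1`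
(`integral_normSq_trace`) this says `|tr U|²` has variance `1`, exactly as for a standard complex Gaussian. References: M. Creutz,
*Quarks, gluons and lattices* (1983) §8; P. Diaconis, M. Shahshahani, J. Appl. Probab. 31A (1994) 49 (moments of traces).
Everything here is proved. [folklore]
-/

noncomputable section

open MeasureTheory Complex
open Literature.MathematicalPhysics.QuantumLattice Literature.MathematicalPhysics.QuantumFieldTheory
open scoped Matrix

namespace Summit.Ventures.YMGap.HaarFourthMomentSUN

open RobustBall.HaarSecondMoments (integral_comp_mul_left diagonal_phase_mem)
open HaarThirdMomentSU3 (eq_zero_of_mul_eq_self)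

section Moments

variable {n : ℕ} {G : Type*} [Group G] [TopologicalSpace G] [IsTopologicalGroup G] [CompactSpace G]
  [MeasurableSpace G] [BorelSpace G] (ρ : G →* Matrix (Fin (2 + n)) (Fin (2 + n)) ℂ)

/-- Local shorthand: the diagonal monomial `U_ii U_kk conj(U_jj) conj(U_ll)`. -/
local notation3 (prettyPrint := false) "𝔪" M:max i:max k:max j:max l:max =>
  M i i * M k k * (starRingEnd ℂ) (M j j) * (starRingEnd ℂ) (M l l)

/-- Local shorthand: the twist coefficient of row `r` under `diag(i at a, −i at b)`. -/
local notation3 (prettyPrint := false) "tc" a:max b:max r:max =>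
  (if r = a then Complex.I else if r = b then -Complex.I else (1 : ℂ))

/-- Entries of the twisted matrix: `(D M)_{rc} = tc_r · M_{rc}` for `D = diag(i at a, −i at b)`. [folklore] -/
theorem twist_mul_apply {a b : Fin (2 + n)} (hab : a ≠ b) (M : Matrix (Fin (2 + n)) (Fin (2 + n)) ℂ) (r c : Fin (2 + n)) :
    (Matrix.diagonal (Pi.mulSingle a Complex.I * Pi.mulSingle b (-Complex.I) : Fin (2 + n) → ℂ) * M) r c =
      (tc a b r) * M r c := by
  rw [Matrix.diagonal_mul, Pi.mul_apply]
  by_cases hra : r = a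
  · subst hra
    simp [Pi.mulSingle_eq_of_ne hab]
  · by_cases hrb : r = b
    · subst hrb
      simp [hra]
    · simp [hra, hrb]

/-- **The twist relation**: `∫ 𝔪 = φ · ∫ 𝔪` with `φ = tc_i tc_k conj(tc_j) conj(tc_l)`; hence `∫ 𝔪 = 0` whenever `φ ≠ 1`. [folklore] -/
theorem integral_diag4_eq_zero (hρ : IsSpecialUnitaryModel ρ) {a b : Fin (2 + n)} (hab : a ≠ b) (i k j l : Fin (2 + n))
    (φ : ℂ) (hφ : φ ≠ 1) (hcoef : (tc a b i) * (tc a b k) * (starRingEnd ℂ) (tc a b j) * (starRingEnd ℂ) (tc a b l) = φ) :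
    ∫ g, 𝔪 (ρ g) i k j l ∂haarProbability G = 0 := by
  set D := Matrix.diagonal (Pi.mulSingle a Complex.I * Pi.mulSingle b (-Complex.I) : Fin (2 + n) → ℂ) with hD
  have hDm : D ∈ Matrix.specialUnitaryGroup (Fin (2 + n)) ℂ := by rw [hD]; exact diagonal_phase_mem a b hab
  have h := integral_comp_mul_left ρ hρ hDm (fun M => 𝔪 M i k j l)
  have hpt : ∀ M : Matrix (Fin (2 + n)) (Fin (2 + n)) ℂ, 𝔪 (D * M) i k j l = φ * 𝔪 M i k j l := by
    intro M
    rw [hD, twist_mul_apply hab, twist_mul_apply hab, twist_mul_apply hab, twist_mul_apply hab, map_mul, map_mul, ← hcoef]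
    ring
  simp only [hpt] at h
  rw [integral_const_mul] at h
  exact eq_zero_of_mul_eq_self hφ h

/-- Integrability of the diagonal monomials. [folklore] -/
theorem integrable_diag4 (hρ : Continuous ρ) (i k j l : Fin (2 + n)) :
    Integrable (fun g => 𝔪 (ρ g) i k j l) (haarProbability G) :=
  ((((hρ.matrix_elem i i).mul (hρ.matrix_elem k k)).mul (Complex.continuous_conj.comp (hρ.matrix_elem j j))).mul
    (Complex.continuous_conj.comp (hρ.matrix_elem l l))).integrable_of_hasCompactSupport (HasCompactSupport.of_compactSpace _)

/-- A spare index: for `i j : Fin (2+n)` with `n ≥ 1` there is `m ∉ {i, j}`. [folklore] -/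
theorem exists_third (hn : 1 ≤ n) (i j : Fin (2 + n)) : ∃ m : Fin (2 + n), m ≠ i ∧ m ≠ j := by
  by_contra hcon
  push Not at hcon
  have hsub : (Finset.univ : Finset (Fin (2 + n))) ⊆ {i, j} := fun m _ => by
    rcases eq_or_ne m i with h | h
    · simp [h]
    · simp [hcon m h]
  have hcard := Finset.card_le_card hsub
  rw [Finset.card_univ, Fintype.card_fin] at hcard
  have h2 : ({i, j} : Finset (Fin (2 + n))).card ≤ 2 := Finset.card_le_two
  omega

/-- **The diagonal case `i = k`**: `∫ U_ii² Ū_jj Ū_ll = 0` unless `j = l = i`. [folklore] -/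
theorem integral_diag4_eq_zero_of_eq (hρ : IsSpecialUnitaryModel ρ) (hn : 1 ≤ n) (i j l : Fin (2 + n))
    (h : ¬(j = i ∧ l = i)) : ∫ g, 𝔪 (ρ g) i i j l ∂haarProbability G = 0 := by
  have hnI : (-Complex.I : ℂ) ≠ 1 := fun h' => by have := congrArg Complex.im h'; simp at this
  by_cases hji : j = i
  · rw [hji] at h ⊢
    have hli : l ≠ i := fun hl => h ⟨rfl, hl⟩
    have hil : i ≠ l := fun h => hli h.symm
    -- U_ii² Ū_ii Ū_ll: twist (i, l): I·I·conj(I)·conj(−I) = −1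
    refine integral_diag4_eq_zero ρ hρ hil i i i l (-1) (by norm_num) ?_
    simp [hli, Complex.conj_I]
  · have hij : i ≠ j := fun h => hji h.symm
    by_cases hlj : l = j
    · rw [hlj]
      -- U_ii² Ū_jj²: twist (i, m) with a spare index m ∉ {i, j}
      obtain ⟨m, hmi, hmj⟩ := exists_third hn i j
      have him : i ≠ m := fun h => hmi h.symm
      have hjm : j ≠ m := fun h => hmj h.symm
      refine integral_diag4_eq_zero ρ hρ him i i j j (-1) (by norm_num) ?_
      simp [hji, hjm, Complex.I_mul_I]
    · have hjl : j ≠ l := fun h => hlj h.symm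
      by_cases hli : l = i
      · rw [hli]
        -- U_ii² Ū_jj Ū_ii with j ≠ i: twist (i, j): I·I·conj(−I)·conj(I) = −1
        refine integral_diag4_eq_zero ρ hρ hij i i j i (-1) (by norm_num) ?_
        simp [hji, Complex.conj_I]
      · have hil : i ≠ l := fun h => hli h.symm
        -- U_ii² Ū_jj Ū_ll, j, l ≠ i, l ≠ j: twist (i, j): I·I·conj(−I)·1 = −I
        refine integral_diag4_eq_zero ρ hρ hij i i j l (-Complex.I) hnI ?_
        simp [hji, hli, hlj, Complex.conj_I]

/-- **The off-diagonal case `i ≠ k`**: `∫ U_ii U_kk Ū_jj Ū_ll = 0` unless `(j, l) ∈ {(i, k), (k, i)}`. [folklore] -/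
theorem integral_diag4_eq_zero_of_ne (hρ : IsSpecialUnitaryModel ρ) {i k : Fin (2 + n)} (hik : i ≠ k) (j l : Fin (2 + n))
    (h1 : ¬(j = i ∧ l = k)) (h2 : ¬(j = k ∧ l = i)) : ∫ g, 𝔪 (ρ g) i k j l ∂haarProbability G = 0 := by
  have hI : (Complex.I : ℂ) ≠ 1 := fun h' => by have := congrArg Complex.im h'; simp at this
  have hnI : (-Complex.I : ℂ) ≠ 1 := fun h' => by have := congrArg Complex.im h'; simp at this
  have hki : k ≠ i := fun h => hik h.symm
  by_cases hji : j = i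
  · rw [hji] at h1 h2 ⊢
    have hlk : l ≠ k := fun hl => h1 ⟨rfl, hl⟩
    have hkl : k ≠ l := fun h => hlk h.symm
    by_cases hli : l = i
    · rw [hli]
      -- U_ii U_kk Ū_ii Ū_ii: twist (k, i): tc_i = −I, tc_k = I ⇒ (−I)(I)(I)(I) = −1
      refine integral_diag4_eq_zero ρ hρ hki i k i i (-1) (by norm_num) ?_
      simp [hik, Complex.conj_I]
    · have hil : i ≠ l := fun h => hli h.symm
      -- U_ii U_kk Ū_ii Ū_ll, l ∉ {i, k}: twist (k, l): tc_i = 1, tc_k = I, conj(tc_l) = conj(−I) = I ⇒ −1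
      refine integral_diag4_eq_zero ρ hρ hkl i k i l (-1) (by norm_num) ?_
      simp [hik, hil, hlk, Complex.conj_I]
  · have hij : i ≠ j := fun h => hji h.symm
    by_cases hjk : j = k
    · rw [hjk] at h1 h2 ⊢
      have hli : l ≠ i := fun hl => h2 ⟨rfl, hl⟩
      have hil : i ≠ l := fun h => hli h.symm
      by_cases hlk : l = k
      · rw [hlk]
        -- U_ii U_kk Ū_kk Ū_kk: twist (i, k): I·(−I)·(I)·(I) = −1
        refine integral_diag4_eq_zero ρ hρ hik i k k k (-1) (by norm_num) ?_
        simp [hki, Complex.conj_I]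
      · have hkl : k ≠ l := fun h => hlk h.symm
        -- U_ii U_kk Ū_kk Ū_ll, l ∉ {i, k}: twist (i, l): I·1·1·conj(−I) = −1
        refine integral_diag4_eq_zero ρ hρ hil i k k l (-1) (by norm_num) ?_
        simp [hki, hli, hkl, Complex.conj_I]
    · have hkj : k ≠ j := fun h => hjk h.symm
      -- j ∉ {i, k}: twist (i, j): tc_i = I, tc_k = 1, conj(tc_j) = I, conj(tc_l) ∈ {−I, I, 1}
      by_cases hli : l = i
      · rw [hli]
        refine integral_diag4_eq_zero ρ hρ hij i k j i Complex.I hI ?_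
        simp [hki, hji, hkj, Complex.conj_I]
      · have hil : i ≠ l := fun h => hli h.symm
        by_cases hlj : l = j
        · rw [hlj]
          refine integral_diag4_eq_zero ρ hρ hij i k j j (-Complex.I) hnI ?_
          simp [hki, hji, hkj, Complex.conj_I]
        · have hjl : j ≠ l := fun h => hlj h.symm
          refine integral_diag4_eq_zero ρ hρ hij i k j l (-1) (by norm_num) ?_
          simp [hki, hji, hkj, hli, hlj, Complex.conj_I]

/-- **Simultaneous signed swap of rows and columns**: `|((T M) T)_{rc}| = |M_{σr σc}|` for the signed transposition
`T` of `a ≠ b` and `σ = (a b)`. [folklore] -/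
theorem normSq_conj_swap {a b : Fin (2 + n)} (hab : a ≠ b) (M : Matrix (Fin (2 + n)) (Fin (2 + n)) ℂ) (r c : Fin (2 + n)) :
    Complex.normSq ((Matrix.swap ℂ a b * Matrix.diagonal (Pi.mulSingle a (-1 : ℂ)) * M *
        (Matrix.swap ℂ a b * Matrix.diagonal (Pi.mulSingle a (-1 : ℂ)))) r c) =
      Complex.normSq (M (Equiv.swap a b r) (Equiv.swap a b c)) := by
  set T : Matrix (Fin (2 + n)) (Fin (2 + n)) ℂ := Matrix.swap ℂ a b * Matrix.diagonal (Pi.mulSingle a (-1 : ℂ)) with hT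
  have hrow : ∀ (X : Matrix (Fin (2 + n)) (Fin (2 + n)) ℂ) (r c : Fin (2 + n)),
      Complex.normSq ((T * X) r c) = Complex.normSq (X (Equiv.swap a b r) c) := by
    intro X r c
    rw [hT, Matrix.mul_assoc]
    by_cases hra : r = a
    · rw [hra, Matrix.swap_mul_apply_left, Matrix.diagonal_mul, Equiv.swap_apply_left]
      simp [Pi.mulSingle_eq_of_ne hab.symm]
    · by_cases hrb : r = b
      · rw [hrb, Matrix.swap_mul_apply_right, Matrix.diagonal_mul, Equiv.swap_apply_right]
        simp
      · rw [Matrix.swap_mul_of_ne hra hrb, Matrix.diagonal_mul, Equiv.swap_apply_of_ne_of_ne hra hrb]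
        simp [Pi.mulSingle_eq_of_ne hra]
  have hcol : ∀ (X : Matrix (Fin (2 + n)) (Fin (2 + n)) ℂ) (r c : Fin (2 + n)),
      Complex.normSq ((X * T) r c) = Complex.normSq (X r (Equiv.swap a b c)) := by
    intro X r c
    rw [hT, ← Matrix.mul_assoc, Matrix.mul_diagonal]
    by_cases hca : c = a
    · rw [hca, Matrix.mul_swap_apply_left, Equiv.swap_apply_left]; simp
    · by_cases hcb : c = b
      · rw [hcb, Matrix.mul_swap_apply_right, Equiv.swap_apply_right]; simp [Pi.mulSingle_eq_of_ne hab.symm]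
      · rw [Matrix.mul_swap_of_ne hca hcb, Equiv.swap_apply_of_ne_of_ne hca hcb]
        simp [Pi.mulSingle_eq_of_ne hca]
  rw [hcol (T * M) r c, hrow M r]

/-- `∫ |U_pp|²|U_qq|² = ∫ |U_{σp σp}|²|U_{σq σq}|²` for `σ = (a b)`, `a ≠ b` (conjugation invariance of Haar measure by the signed
transposition). [folklore] -/
theorem integral_normSq_diag_mul_swap (hρ : IsSpecialUnitaryModel ρ) {a b : Fin (2 + n)} (hab : a ≠ b) (p q : Fin (2 + n)) :
    ∫ g, Complex.normSq (ρ g p p) * Complex.normSq (ρ g q q) ∂haarProbability G =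
      ∫ g, Complex.normSq (ρ g (Equiv.swap a b p) (Equiv.swap a b p)) *
        Complex.normSq (ρ g (Equiv.swap a b q) (Equiv.swap a b q)) ∂haarProbability G := by
  have hTm : Matrix.swap ℂ a b * Matrix.diagonal (Pi.mulSingle a (-1 : ℂ)) ∈ Matrix.specialUnitaryGroup (Fin (2 + n)) ℂ :=
    RobustBall.HaarSecondMoments.swap_mul_sign_mem a b hab
  have h := RobustBall.HaarSecondMoments.integral_comp_mul_left ρ hρ hTm
    (fun M => Complex.normSq ((M * (Matrix.swap ℂ a b * Matrix.diagonal (Pi.mulSingle a (-1 : ℂ)))) p p) *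
      Complex.normSq ((M * (Matrix.swap ℂ a b * Matrix.diagonal (Pi.mulSingle a (-1 : ℂ)))) q q))
  have h' := RobustBall.HaarSecondMoments.integral_comp_mul_right ρ hρ hTm
    (fun M => Complex.normSq (M p p) * Complex.normSq (M q q))
  beta_reduce at h h'
  rw [← h', ← h]
  simp_rw [normSq_conj_swap hab]

/-- `∫ |U_ii|⁴ = ∫ |U₀₀|⁴` for every `i`. [folklore] -/
theorem integral_normSq_diag_sq_eq (hρ : IsSpecialUnitaryModel ρ) (i : Fin (2 + n)) :
    ∫ g, Complex.normSq (ρ g i i) ^ 2 ∂haarProbability G = ∫ g, Complex.normSq (ρ g 0 0) ^ 2 ∂haarProbability G := by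
  rcases eq_or_ne i 0 with rfl | hi0
  · rfl
  have h := integral_normSq_diag_mul_swap ρ hρ hi0.symm i i
  rw [Equiv.swap_apply_right] at h
  simp_rw [← pow_two] at h
  exact h

/-- `∫ |U_ii|²|U_kk|² = ∫ |U₀₀|²|U₁₁|²` for every `i ≠ k`. [folklore] -/
theorem integral_normSq_diag_mul_eq (hρ : IsSpecialUnitaryModel ρ) {i k : Fin (2 + n)} (hik : i ≠ k) :
    ∫ g, Complex.normSq (ρ g i i) * Complex.normSq (ρ g k k) ∂haarProbability G =
      ∫ g, Complex.normSq (ρ g 0 0) * Complex.normSq (ρ g 1 1) ∂haarProbability G := by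
  have h10 : (1 : Fin (2 + n)) ≠ 0 := one_ne_zero_fin
  -- step 1: move i to 0
  have step1 : ∀ {i k : Fin (2 + n)}, i ≠ k →
      ∃ k' : Fin (2 + n), k' ≠ 0 ∧ ∫ g, Complex.normSq (ρ g i i) * Complex.normSq (ρ g k k) ∂haarProbability G =
        ∫ g, Complex.normSq (ρ g 0 0) * Complex.normSq (ρ g k' k') ∂haarProbability G := by
    intro i k hik
    rcases eq_or_ne i 0 with rfl | hi0
    · exact ⟨k, hik.symm, rfl⟩
    refine ⟨Equiv.swap 0 i k, ?_, ?_⟩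
    · intro h0
      exact hik ((Equiv.swap (0 : Fin (2 + n)) i).injective (h0.trans (Equiv.swap_apply_right 0 i).symm)).symm
    · rw [integral_normSq_diag_mul_swap ρ hρ hi0.symm i k, Equiv.swap_apply_right]
  -- step 2: with i = 0, move k' to 1 by the swap (1 k') fixing 0
  obtain ⟨k', hk', e⟩ := step1 hik
  rw [e]
  rcases eq_or_ne k' 1 with rfl | hk1
  · rfl
  rw [integral_normSq_diag_mul_swap ρ hρ hk1.symm 0 k', Equiv.swap_apply_of_ne_of_ne h10.symm hk'.symm,
    Equiv.swap_apply_right]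

/-- The inner double sum for `i = k`: only `j = l = i` survives, giving `∫|U₀₀|⁴`. [folklore] -/
theorem sum_diag4_eq (hρ : IsSpecialUnitaryModel ρ) (hn : 1 ≤ n) (i : Fin (2 + n)) :
    ∑ j, ∑ l, ∫ g, 𝔪 (ρ g) i i j l ∂haarProbability G = ((∫ g, Complex.normSq (ρ g 0 0) ^ 2 ∂haarProbability G : ℝ) : ℂ) := by
  rw [Finset.sum_eq_single i (fun j _ hj => Finset.sum_eq_zero fun l _ =>
      integral_diag4_eq_zero_of_eq ρ hρ hn i j l fun h => hj h.1) (fun h => absurd (Finset.mem_univ i) h),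
    Finset.sum_eq_single i (fun l _ hl => integral_diag4_eq_zero_of_eq ρ hρ hn i i l fun h => hl h.2)
      (fun h => absurd (Finset.mem_univ i) h)]
  have hpt : ∀ g : G, 𝔪 (ρ g) i i i i = ((Complex.normSq (ρ g i i) ^ 2 : ℝ) : ℂ) := fun g => by
    push_cast
    rw [← Complex.mul_conj]
    ring
  simp_rw [hpt]
  rw [integral_complex_ofReal, integral_normSq_diag_sq_eq ρ hρ i]

/-- The inner double sum for `i ≠ k`: only `(j,l) = (i,k), (k,i)` survive, giving `2 ∫|U₀₀|²|U₁₁|²`. [folklore] -/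
theorem sum_diag4_ne (hρ : IsSpecialUnitaryModel ρ) {i k : Fin (2 + n)} (hik : i ≠ k) :
    ∑ j, ∑ l, ∫ g, 𝔪 (ρ g) i k j l ∂haarProbability G =
      2 * ((∫ g, Complex.normSq (ρ g 0 0) * Complex.normSq (ρ g 1 1) ∂haarProbability G : ℝ) : ℂ) := by
  have hki : k ≠ i := fun h => hik h.symm
  -- the j-sum is supported on {i, k}
  have hsupp : ∀ j ∈ (Finset.univ : Finset (Fin (2 + n))), j ∉ ({i, k} : Finset (Fin (2 + n))) →
      ∑ l, ∫ g, 𝔪 (ρ g) i k j l ∂haarProbability G = 0 := by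
    intro j _ hj
    have hji : j ≠ i := fun h => hj (by simp [h])
    have hjk : j ≠ k := fun h => hj (by simp [h])
    exact Finset.sum_eq_zero fun l _ => integral_diag4_eq_zero_of_ne ρ hρ hik j l (fun h => hji h.1) (fun h => hjk h.1)
  rw [← Finset.sum_subset (Finset.subset_univ ({i, k} : Finset (Fin (2 + n)))) hsupp, Finset.sum_pair hik]
  -- j = i: only l = k survives; j = k: only l = i survives
  rw [Finset.sum_eq_single k (fun l _ hl => integral_diag4_eq_zero_of_ne ρ hρ hik i l (fun h => hl h.2)
      (fun h => hik h.1)) (fun h => absurd (Finset.mem_univ k) h),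
    Finset.sum_eq_single i (fun l _ hl => integral_diag4_eq_zero_of_ne ρ hρ hik k l (fun h => hki h.1)
      (fun h => hl h.2)) (fun h => absurd (Finset.mem_univ i) h)]
  have hpt1 : ∀ g : G, 𝔪 (ρ g) i k i k = ((Complex.normSq (ρ g i i) * Complex.normSq (ρ g k k) : ℝ) : ℂ) := fun g => by
    push_cast
    rw [← Complex.mul_conj, ← Complex.mul_conj]
    ring
  have hpt2 : ∀ g : G, 𝔪 (ρ g) i k k i = ((Complex.normSq (ρ g i i) * Complex.normSq (ρ g k k) : ℝ) : ℂ) := fun g => by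
    push_cast
    rw [← Complex.mul_conj, ← Complex.mul_conj]
    ring
  simp_rw [hpt1, hpt2]
  rw [integral_complex_ofReal, integral_normSq_diag_mul_eq ρ hρ hik, ← two_mul]

/-- ★★ **`∫ |tr ρ(g)|⁴ dg = 2` for every compact group `G ≅ SU(N)`, `N ≥ 3`** — the fourth moment of the fundamental character is
that of a standard complex Gaussian (the number of invariants in `V⊗V⊗V̄⊗V̄`). [folklore] -/
theorem integral_normSq_trace_sq (hρ : IsSpecialUnitaryModel ρ) (hn : 1 ≤ n) :
    ∫ g, Complex.normSq (ρ g).trace ^ 2 ∂haarProbability G = 2 := by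
  -- complex form: |tr|⁴ = Σ_{i,k,j,l} 𝔪 i k j l
  have hexp : ∀ g : G, (((Complex.normSq (ρ g).trace ^ 2 : ℝ)) : ℂ) = ∑ i, ∑ k, ∑ j, ∑ l, 𝔪 (ρ g) i k j l := by
    intro g
    have hz : (ρ g).trace * (starRingEnd ℂ) (ρ g).trace = ∑ i, ∑ j, ρ g i i * (starRingEnd ℂ) (ρ g j j) := by
      rw [Matrix.trace, map_sum, Finset.sum_mul_sum]
      rfl
    rw [Complex.ofReal_pow, ← Complex.mul_conj, pow_two, hz, Finset.sum_mul_sum]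
    refine Finset.sum_congr rfl fun i _ => Finset.sum_congr rfl fun k _ => ?_
    rw [Finset.sum_mul_sum]
    refine Finset.sum_congr rfl fun j _ => Finset.sum_congr rfl fun l _ => ?_
    ring
  have hC : ((∫ g, Complex.normSq (ρ g).trace ^ 2 ∂haarProbability G : ℝ) : ℂ) = 2 := by
    rw [← integral_complex_ofReal]
    simp_rw [hexp]
    rw [integral_finsetSum _ (fun i _ => integrable_finsetSum _ fun k _ => integrable_finsetSum _ fun j _ =>
      integrable_finsetSum _ fun l _ => integrable_diag4 ρ hρ.1 i k j l)]
    have hin1 : ∀ i : Fin (2 + n), ∫ g, ∑ k, ∑ j, ∑ l, 𝔪 (ρ g) i k j l ∂haarProbability G =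
        ∑ k, ∑ j, ∑ l, ∫ g, 𝔪 (ρ g) i k j l ∂haarProbability G := by
      intro i
      rw [integral_finsetSum _ (fun k _ => integrable_finsetSum _ fun j _ =>
        integrable_finsetSum _ fun l _ => integrable_diag4 ρ hρ.1 i k j l)]
      refine Finset.sum_congr rfl fun k _ => ?_
      rw [integral_finsetSum _ (fun j _ => integrable_finsetSum _ fun l _ => integrable_diag4 ρ hρ.1 i k j l)]
      refine Finset.sum_congr rfl fun j _ => ?_
      rw [integral_finsetSum _ (fun l _ => integrable_diag4 ρ hρ.1 i k j l)]
    simp_rw [hin1]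
    -- split k = i / k ≠ i
    have hinner : ∀ i : Fin (2 + n), ∑ k, ∑ j, ∑ l, ∫ g, 𝔪 (ρ g) i k j l ∂haarProbability G =
        ((∫ g, Complex.normSq (ρ g 0 0) ^ 2 ∂haarProbability G : ℝ) : ℂ) +
          (1 + n : ℂ) * (2 * ((∫ g, Complex.normSq (ρ g 0 0) * Complex.normSq (ρ g 1 1) ∂haarProbability G : ℝ) : ℂ)) := by
      intro i
      rw [← Finset.add_sum_erase _ _ (Finset.mem_univ i), sum_diag4_eq ρ hρ hn i]
      congr 1
      rw [Finset.sum_congr rfl (fun k hk => sum_diag4_ne ρ hρ (Finset.ne_of_mem_erase hk).symm), Finset.sum_const,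
        Finset.card_erase_of_mem (Finset.mem_univ _), Finset.card_univ, Fintype.card_fin, nsmul_eq_mul]
      congr 1
      rw [show 2 + n - 1 = 1 + n by omega]; push_cast; ring
    simp_rw [hinner]
    rw [Finset.sum_const, Finset.card_univ, Fintype.card_fin, nsmul_eq_mul, integral_normSq_sq ρ hρ hn,
      integral_normSq_mul_normSq_diag ρ hρ hn]
    have h2 : (2 + n : ℂ) ≠ 0 := by exact_mod_cast (show (2 + n : ℕ) ≠ 0 by omega)
    have h3 : (3 + n : ℂ) ≠ 0 := by exact_mod_cast (show (3 + n : ℕ) ≠ 0 by omega)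
    have h1 : (1 + n : ℂ) ≠ 0 := by exact_mod_cast (show (1 + n : ℕ) ≠ 0 by omega)
    push_cast
    field_simp
    ring
  exact_mod_cast hC

/-- ★ **`Var |tr ρ(g)|² = 1`**: `∫ (|tr|² − 1)² dg = 1` for `G ≅ SU(N)`, `N ≥ 3` (with `∫|tr|² = 1`). [folklore] -/
theorem integral_normSq_trace_sub_one_sq (hρ : IsSpecialUnitaryModel ρ) (hn : 1 ≤ n) :
    ∫ g, (Complex.normSq (ρ g).trace - 1) ^ 2 ∂haarProbability G = 1 := by
  have hc : Continuous fun g : G => Complex.normSq (ρ g).trace := Complex.continuous_normSq.comp hρ.1.matrix_trace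
  have i2 : Integrable (fun g => Complex.normSq (ρ g).trace ^ 2) (haarProbability G) :=
    (hc.pow 2).integrable_of_hasCompactSupport (HasCompactSupport.of_compactSpace _)
  have i1 : Integrable (fun g => Complex.normSq (ρ g).trace) (haarProbability G) :=
    hc.integrable_of_hasCompactSupport (HasCompactSupport.of_compactSpace _)
  have hpt : ∀ g : G, (Complex.normSq (ρ g).trace - 1) ^ 2 =
      Complex.normSq (ρ g).trace ^ 2 - 2 * Complex.normSq (ρ g).trace + 1 := fun g => by ring
  simp_rw [hpt]
  have i12 : Integrable (fun g => Complex.normSq (ρ g).trace ^ 2 - 2 * Complex.normSq (ρ g).trace) (haarProbability G) :=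
    i2.sub (i1.const_mul 2)
  rw [integral_add i12 (integrable_const 1), integral_sub i2 (i1.const_mul 2), integral_const_mul,
    integral_normSq_trace_sq ρ hρ hn, RobustBall.HaarSecondMoments.integral_normSq_trace ρ hρ (by omega), integral_const]
  simp

end Moments

/-! ### The concrete group `SU(N)`, `N ≥ 3` -/

/-- ★★ **`∫_{SU(N)} |tr U|⁴ dU = 2`** for every `N ≥ 3`, in the venture's vocabulary. [folklore] -/
theorem integral_normSq_trace_sq_suN {N : ℕ} (hN : 3 ≤ N) :
    ∫ U, Complex.normSq (U : Matrix (Fin N) (Fin N) ℂ).trace ^ 2 ∂haarProbability (Matrix.specialUnitaryGroup (Fin N) ℂ) = 2 := by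
  obtain ⟨n, rfl⟩ := Nat.exists_eq_add_of_le (show 2 ≤ N by omega)
  have h := integral_normSq_trace_sq (n := n) (fundamentalRep (Fin (2 + n)))
    (TorusAreaLaw.isSpecialUnitaryModel_fundamentalRep (2 + n)) (by omega)
  simpa only [fundamentalRep_apply] using h

end Summit.Ventures.YMGap.HaarFourthMomentSUN
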